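import Summits.QuantumFields.BalabanUV.T4Continuum.Support.ShellMeasureLandauHolonomyWeight
import Summits.QuantumFields.BalabanUV.T4Continuum.Support.ShellMeasureLandauPinnedFixedPoint
import Summits.QuantumFields.BalabanUV.T4Continuum.Support.ShellMeasureWilsonSquare
import Summits.QuantumFields.BalabanUV.T4Continuum.Support.ShellMeasureLandauHolonomyToy

/-!
# `T4Continuum.ShellMeasureLandauHolonomyStokes` — row S73: END-II's (AN-bound) `hAN` IN THE STOKES CURRENCY — the
# canonical Landau holonomy on the chart re-concluded with ONE MORE DISPLAYED read-out binder, the CURL read-out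
# `‖Σ_{b∈∂p} ℓ_b(Y)‖ ≤ κ_c‖Y‖`, so that `H_AN = κ_c·z̄ + expTail₂(m·κ·z̄)` (second order in the fine-bond letters) instead of
# the letter-wise `e^{m·κ·z̄} − 1`; + the (SM) junction in `ShellMeasureWilsonSquare.stokes_hSM`'s shape
(cell `pub-balaban`, sub-cell `t4`, spine estimate NE7c (node U5b); NE7c ROUND-2 crew lineage
`b2b-balaban-t4-ne7c-formalise-leaf-05` gen 7, owner table `t4/b2b-balaban-t4-ne7c-p1/LEAVES-NE7c-P1.md` v3.1 row S73
(CLAIM journal l.16794); ADDITIVE — imports the LD chain's (B) `ShellMeasureLandauHolonomyWeight` (p213679: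
`landauCurve_along`; hence `ShellMeasureLandauHolonomyChart` p212418: `holOf`, `cplx`, `rayData_chart`, and file 7′
`ShellMeasureLandauHolonomy` p212141: `solAt`, `landauExp`, `solAt_along`), leaf-07-g6's `ShellMeasureLandauPinnedFixedPoint`
(p224417: `landauExp_zero`) and the owner's S72 `ShellMeasureWilsonSquare` (p225012: `stokes_H_le`, `stokes_hSM`; hence
`T4ShellMeasurePlaquette` p190569: `plaquetteFn`, `norm_plaquetteFn_le_of_uniform`, `expTail₂`) and, for the non-vacuity
`example` of §6 only, leaf-02's model `ShellMeasureLandauHolonomyToy` (p213511); [folklore]; 0 `def`, 0 `def … : Prop`,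
0 sorry, 0 citations)

HONEST FRAMING.  Finite four-torus programme, rung (B)+1 only — NOT infinite volume, NOT a mass gap, NOT the Clay
problem, NOT summit progress; (B), `BetaPertHyp`, (B^μ) are not consumed.  NE7c (`T4IndicatorShell.ShellWeightBound`) is
NOT PRINTED in [Balaban 1983–89] and NOT PROVED; «NE7c ⇐ the named binders» (WALL `t4/b2b-balaban-t4-ne7c-p1/WALL-NE7c-P1.md`
§2).  Nothing printed is asserted: (P2), (P4), (118)∕(121), (44)+[4] Prop. 7, (46), (54), (75)∕(103) and the read-out norms
are TYPED HYPOTHESES of the imported files, by name; the NEW binder `hcurl` (the CURL read-out norm `κ_c` — for Bałaban's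
minimiser `∝ η²`: [Balaban1985Variational] (19) n = 1 ∕ (25) «equal to η(DA)(p)» ∕ (37) TYPE) is DISPLAYED, located, NOT
asserted and NOT discharged.  No `def`, no `def … : Prop`.
HONEST DEPENDENCY (cell): continuum YM on T⁴ ⇐ BetaPertH ∧ nine spine estimates (0/9 proved); BetaPertH ⇐ (D1) ∧ (D4) ∧
CAP+tail; G-an2-4 gates asym, D1 and NE2/3/4.

THE POINT (owner FINDING F-ne7cp1-g31-1, GAPS l.25754; S72's header (i)).  END-II
(`ShellMeasureLevelAssembly.slotAntiConcentration_of_levelData`) consumes the classifier through the pair of binders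
`hAN : ∀ x ∈ W, ∀ p ∈ P_u, ∃ f` (holomorphic on `‖w‖ < R`, `‖f‖ ≤ H`, `f 0 = 0`, `f c = hol p (c•x) − 1`) and
`hSM : 36·H·1²∕(R − 1)² ≤ δ·θ`.  The LD chain of record inhabits `hAN` LETTER-WISE
(`ShellMeasureLandauHolonomyChart.hAN_of_consistentCurves` → `ShellMeasureLevelAssembly.classifierWitness_of_bondData` →
`norm_wordExp_sub_one_le`): `H = e^{m·κ·z̄} − 1 ≥ m·κ·z̄`, FIRST order in the fine-bond letters (`∝ η_j` at live level `j`),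
while B14 (2.17)'s threshold is `θ_j ∝ η_j²` — S72 `letterwise_hSM_fails`.  The η²-correct currency is lattice STOKES: the
word of exponentials of the letters around `∂p` minus one is bounded by the NORM OF THE LETTER SUM plus a second-order tail,
`‖∏ e^{X_b} − 1‖ ≤ ‖Σ X_b‖ + expTail₂(Σ‖X_b‖)` (`T4ShellMeasurePlaquette.norm_plaquetteFn_le_of_uniform`, in the tree since
gen 9), and the letter sum `Σ_{b∈∂p} ℓ_b` is ONE linear functional of the exponent field — the discrete curl at `p` — whose
norm `κ_c` is a read-out datum of its own (`∝ η²`).  THIS FILE re-runs the three `hAN` theorems of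
`ShellMeasureLandauHolonomyChart` with that one extra DISPLAYED binder and the Stokes `H`:
* §1 `classifierWitness_of_bondData_stokes` — the bond-level witness (`plaquetteFn`) with `H = s₁ + expTail₂(ℓ·a)` from a
  letter-SUM bound `s₁` on the disc;
* §2 **`hAN_of_consistentCurves_stokes`** — END-II's `hAN` for `hol p := holOf (ℓs p) Z` from ray-consistent holomorphic
  curves, binders of `hAN_of_consistentCurves` + `hcurl : ∀ p ∈ P_u, ∀ Y, ‖((ℓs p).map (· Y)).sum‖ ≤ κ_c‖Y‖`, conclusion
  with `H := κ_c·z̄ + expTail₂(m·(κ·z̄))` (the spelling `‖(ℓs p).sum Y‖ ≤ κ_c‖Y‖` converts by `hcurl_of_sum`);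
* §3 `hAN_landau_of_consistentData_stokes` — the scheme's canonical Landau holonomy from ray-consistent data (S22 binders
  by name), `z̄ = (ε₄ + a) + B₀·4C₂(ε₄ + a)²` (`landauCurve_along`);
* §4 **`hAN_landau_chartRay_stokes`** — THE CHART-RAY INSTANCE (`E = Fin n → ℝ`, window in `closedBall 0 S`, `S < r_Φ`,
  disc `r_Φ∕S`): same binders as `hAN_landau_chartRay` + `hcurl`, same DEFINED holonomy, `H` in the Stokes currency;
* §6 non-vacuity: §4 FIRES on leaf-02's one-mode model (`ShellMeasureLandauHolonomyToy`) with `κ_c = κ = 1`;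
* §5 `hSM_of_stokes` — the (SM) junction: with the η-scalings DISPLAYED as hypotheses (`κ_c·z̄ ≤ c₁η²z`, `κ·z̄ ≤ c₂ηz`,
  `m·κ·z̄ ≤ 1`) and the UNIT-currency smallness `36(c₁z + m²c₂²z²)∕(R − 1)² ≤ δε`, END-II's `hSM` holds LITERALLY at
  `(H, θ) = (κ_c·z̄ + expTail₂(m·κ·z̄), ε·η²)` — S72 `stokes_H_le` + `stokes_hSM`, the `η²` cancels.
NOT HERE: the instantiation of `κ_c`, `κ`, `z̄` for Bałaban's minimiser (node O ∕ [dict]); the weight side (S74); the pinned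
END (S70 f3 consumes §4 + §5 as the classifier tuple of N-ne7cp1-g31-1).  NOTHING in the countdown moves; NE7c NOT PROVED;
spine PROVED 0∕9.
-/

noncomputable section

open Set Metric NormedSpace

namespace Summit.QuantumFields.BalabanUV.T4Continuum.ShellMeasureLandauHolonomyStokes

open Literature.MathematicalPhysics.QuantumFieldTheory.Balaban1983to89
open B11Prop6Scheme (mapT Prop4Hyp)
open T4ShellMeasurePlaquette (plaquetteFn plaquetteFn_eq plaquetteFn_apply_zero differentiableOn_plaquetteFn
  norm_plaquetteFn_le_of_uniform expTail₂ expTail₂_nonneg)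
open ShellMeasureWilsonWords (wordExp)
open ShellMeasureLandauExponent (currentData_zero)
open ShellMeasureLandauHolonomy (solAt corrAt landauExp solAt_along)
open ShellMeasureLandauHolonomyChart (holOf holOf_apply cplx rayData_chart)
open ShellMeasureLandauHolonomyWeight (landauCurve_along)
open ShellMeasureLandauPinnedFixedPoint (landauExp_zero)
open ShellMeasureWilsonSquare (stokes_H_le stokes_hSM)
open ShellMeasureLandauHolonomyToy (toyZ toy_chartMap toy_sectC toy_id_bound toy_prop4)

variable {E : Type*}
variable {𝒴 𝒴' 𝒳 𝒵 : Type*} [NormedAddCommGroup 𝒴] [NormedSpace ℂ 𝒴] [NormedAddCommGroup 𝒴'] [NormedSpace ℂ 𝒴']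
  [NormedAddCommGroup 𝒳] [NormedSpace ℂ 𝒳] [NormedAddCommGroup 𝒵] [NormedSpace ℂ 𝒵]
variable {A : Type*} [NormedRing A] [NormedAlgebra ℂ A] [CompleteSpace A]

/-! ## §1 The bond-level witness in the Stokes currency -/

/-- **(AN-bound) FOR A PLAQUETTE FROM BOND DATA, STOKES CURRENCY.**  Oriented bond variables `X₁, …, X_k : ℂ → A` of `∂p`
along the complexified ray, complex differentiable on `‖w‖ < R`, `‖X_i‖ ≤ a` there, `k ≤ ℓ`, flat centre `X_i 0 = 0`, and a
bound on the LETTER SUM `‖Σ_i X_i(w)‖ ≤ s₁` on the disc; the holonomy along the real ray is their word of exponentials.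
Then `f = plaquetteFn Xs` is END-II's `hAN` witness with `H = s₁ + expTail₂(ℓ·a)`
(`T4ShellMeasurePlaquette.norm_plaquetteFn_le_of_uniform`; the letter-wise sibling is
`ShellMeasureLevelAssembly.classifierWitness_of_bondData`, `H = e^{ℓa} − 1`). [folklore] -/
theorem classifierWitness_of_bondData_stokes {Xs : List (ℂ → A)} {R a s₁ : ℝ} {ℓ : ℕ} {hol : ℝ → A}
    (hX : ∀ X ∈ Xs, DifferentiableOn ℂ X (ball 0 R)) (ha : ∀ X ∈ Xs, ∀ w ∈ ball (0 : ℂ) R, ‖X w‖ ≤ a)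
    (ha0 : 0 ≤ a) (hℓ : Xs.length ≤ ℓ) (hs : ∀ w ∈ ball (0 : ℂ) R, ‖(Xs.map fun X => X w).sum‖ ≤ s₁)
    (h0 : ∀ X ∈ Xs, X 0 = 0) (hhol : ∀ c : ℝ, 0 ≤ c → c ≤ 1 → hol c = wordExp (Xs.map fun X => X (c : ℂ))) :
    ∃ f : ℂ → A, DifferentiableOn ℂ f (ball 0 R) ∧
      (∀ w ∈ ball (0 : ℂ) R, ‖f w‖ ≤ s₁ + expTail₂ (ℓ * a)) ∧ f 0 = 0 ∧
      ∀ c : ℝ, 0 ≤ c → c ≤ 1 → f (c : ℂ) = hol c - 1 := by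
  refine ⟨plaquetteFn Xs, differentiableOn_plaquetteFn hX,
    fun w hw => norm_plaquetteFn_le_of_uniform (fun X hX' => ha X hX' w hw) (hs w hw) ha0 hℓ,
    plaquetteFn_apply_zero h0, fun c hc0 hc1 => ?_⟩
  rw [hhol c hc0 hc1, plaquetteFn_eq]; rfl

/-! ## §2 END-II's `hAN` for `holOf` from ray-consistent holomorphic curves, Stokes currency -/

variable [AddCommGroup E] [Module ℝ E]

omit [CompleteSpace A] in
/-- evaluation commutes with list sums of read-outs: `(Σ ℓ) Y = Σ ℓ(Y)`. [folklore] -/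
theorem list_sum_apply (l : List (𝒴 →L[ℂ] A)) (Y : 𝒴) : l.sum Y = (l.map fun ℓ => ℓ Y).sum := by
  induction l with
  | nil => simp
  | cons ℓ l ih => simp [ih]

omit [CompleteSpace A] in
/-- the curl binder in the «summed functional» spelling `‖(Σ_{ℓ∈ℓs p} ℓ) Y‖ ≤ κ_c‖Y‖` (owner N-ne7cp1-g31-1 ∕ l.16871) gives the
«sum of letters» spelling used below. [folklore] -/
theorem hcurl_of_sum {𝔭 : Type*} {Pu : Finset 𝔭} {ℓs : 𝔭 → List (𝒴 →L[ℂ] A)} {κc : ℝ}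
    (h : ∀ p ∈ Pu, ∀ Y, ‖(ℓs p).sum Y‖ ≤ κc * ‖Y‖) :
    ∀ p ∈ Pu, ∀ Y, ‖((ℓs p).map fun ℓ => ℓ Y).sum‖ ≤ κc * ‖Y‖ := fun p hp Y => by
  rw [← list_sum_apply]; exact h p hp Y

/-- **END-II's `hAN` FOR `holOf` FROM RAY-CONSISTENT HOLOMORPHIC CURVES, STOKES CURRENCY.**  Data as in
`ShellMeasureLandauHolonomyChart.hAN_of_consistentCurves`: window `W ⊆ E`, classifier plaquettes `P_u` with read-out lists
`ℓs p` (`‖ℓ Y‖ ≤ κ‖Y‖`, length `≤ m`), an exponent field `Z : E → 𝒴`, per window point a holomorphic curve `Z_x` on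
`‖σ‖ < Rad` with `‖Z_x σ‖ ≤ z̄`, `Z_x 0 = 0`, ray-consistent (`Z_x c = Z (c • x)` on `[0,1]`) — PLUS ONE MORE DISPLAYED
READ-OUT BINDER, the CURL read-out `hcurl : ‖Σ_{ℓ∈ℓs p} ℓ(Y)‖ ≤ κ_c‖Y‖` (the letter sum around `∂p` as ONE functional of
the exponent; B11 (25)∕(37) TYPE, `κ_c ∝ η²` — located, NOT asserted).  CONCLUSION: END-II's `hAN` binder for
`hol p := holOf (ℓs p) Z`, literally, with `H = κ_c·z̄ + expTail₂(m·(κ·z̄))`. [folklore] -/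
theorem hAN_of_consistentCurves_stokes {𝔭 : Type*} {W : Set E} {Pu : Finset 𝔭} (ℓs : 𝔭 → List (𝒴 →L[ℂ] A))
    {κ : ℝ} (hκ : 0 ≤ κ) (hℓ : ∀ p ∈ Pu, ∀ ℓ ∈ ℓs p, ∀ Y, ‖ℓ Y‖ ≤ κ * ‖Y‖)
    {κc : ℝ} (hκc : 0 ≤ κc) (hcurl : ∀ p ∈ Pu, ∀ Y, ‖((ℓs p).map fun ℓ => ℓ Y).sum‖ ≤ κc * ‖Y‖)
    {m : ℕ} (hlen : ∀ p ∈ Pu, (ℓs p).length ≤ m) (Z : E → 𝒴) {Rad zbar : ℝ} (hz : 0 ≤ zbar) (Zc : E → ℂ → 𝒴)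
    (hZd : ∀ x ∈ W, DifferentiableOn ℂ (Zc x) (ball 0 Rad))
    (hZb : ∀ x ∈ W, ∀ σ ∈ ball (0 : ℂ) Rad, ‖Zc x σ‖ ≤ zbar) (hZ0 : ∀ x ∈ W, Zc x 0 = 0)
    (hray : ∀ x ∈ W, ∀ c : ℝ, 0 ≤ c → c ≤ 1 → Zc x c = Z (c • x)) :
    ∀ x ∈ W, ∀ p ∈ Pu, ∃ f : ℂ → A, DifferentiableOn ℂ f (ball 0 Rad) ∧
      (∀ w ∈ ball (0 : ℂ) Rad, ‖f w‖ ≤ κc * zbar + expTail₂ (m * (κ * zbar))) ∧ f 0 = 0 ∧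
      ∀ c : ℝ, 0 ≤ c → c ≤ 1 → f (c : ℂ) = holOf (ℓs p) Z (c • x) - 1 := by
  intro x hx p hp
  have hd : ∀ Xb ∈ (ℓs p).map (fun ℓ => fun σ => ℓ (Zc x σ)), DifferentiableOn ℂ Xb (ball 0 Rad) := by
    intro Xb hXb
    obtain ⟨ℓ, -, rfl⟩ := List.mem_map.1 hXb
    exact ℓ.differentiable.comp_differentiableOn (hZd x hx)
  have hb : ∀ Xb ∈ (ℓs p).map (fun ℓ => fun σ => ℓ (Zc x σ)), ∀ w ∈ ball (0 : ℂ) Rad, ‖Xb w‖ ≤ κ * zbar := by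
    intro Xb hXb w hw
    obtain ⟨ℓ, hℓm, rfl⟩ := List.mem_map.1 hXb
    exact (hℓ p hp ℓ hℓm _).trans (mul_le_mul_of_nonneg_left (hZb x hx w hw) hκ)
  have h0 : ∀ Xb ∈ (ℓs p).map (fun ℓ => fun σ => ℓ (Zc x σ)), Xb 0 = 0 := by
    intro Xb hXb
    obtain ⟨ℓ, -, rfl⟩ := List.mem_map.1 hXb
    simp [hZ0 x hx]
  have hs : ∀ w ∈ ball (0 : ℂ) Rad,
      ‖(((ℓs p).map (fun ℓ => fun σ => ℓ (Zc x σ))).map fun X => X w).sum‖ ≤ κc * zbar := by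
    intro w hw
    rw [List.map_map]
    exact (hcurl p hp (Zc x w)).trans (mul_le_mul_of_nonneg_left (hZb x hx w hw) hκc)
  have hlen' : ((ℓs p).map (fun ℓ => fun σ => ℓ (Zc x σ))).length ≤ m := by
    rw [List.length_map]; exact hlen p hp
  exact classifierWitness_of_bondData_stokes hd hb (mul_nonneg hκ hz) hlen' hs h0
    (hol := fun c => holOf (ℓs p) Z (c • x))
    (fun c hc0 hc1 => by rw [holOf_apply, ← hray x hx c hc0 hc1, List.map_map]; rfl)

/-! ## §3 The scheme's canonical Landau holonomy on the chart, Stokes currency -/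

section Scheme

variable [CompleteSpace 𝒴] [CompleteSpace 𝒳]
  {𝒢 : 𝒵 →L[ℂ] 𝒴} {Λ : 𝒴 →L[ℂ] 𝒴} {W𝒱 : 𝒴 → 𝒵} {B₀ θ C₄ a₃ : ℝ}

/-- **END-II's `hAN` FOR THE CANONICAL LANDAU HOLONOMY ON THE CHART, STOKES CURRENCY.**  Binders: exactly those of
`ShellMeasureLandauHolonomyChart.hAN_landau_of_consistentData` (S22 list: (P2) `h𝒢`∕`hΛ`; (P4) `hW`; (118)∕(121); (44)+[4]
Prop. 7 `hCq`∕`hCd`; scaling `hι`; (46) `hH`; (54)-smallness; per-window-point holomorphic data `J_x`, `𝔄_x` on a common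
disc, flat, RAY-CONSISTENT with chart data `Jof`, `𝔄of`; read-outs `ℓs p`, `‖ℓ Y‖ ≤ κ‖Y‖`, length `≤ m`) PLUS the curl
read-out `hcurl`.  CONCLUSION: END-II's `hAN`, literally, for the DEFINED holonomy
`hol p := holOf (ℓs p) (y ↦ landauExp C ι H (4C₂(ε₄+a)²) (solAt 𝒢 Λ W𝒱 ε₄ (Jof y) (𝔄of y) + 𝔄of y))` with
`H = κ_c·z̄ + expTail₂(m·κ·z̄)`, `z̄ = (ε₄ + a) + B₀·4C₂(ε₄ + a)²` (`landauCurve_along`; flat centre by `solAt_along` +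
`landauExp_zero`). [folklore] -/
theorem hAN_landau_of_consistentData_stokes {𝔭 : Type*} {W : Set E} {Pu : Finset 𝔭}
    (h𝒢 : ∀ f, ‖𝒢 f‖ ≤ B₀ * ‖f‖) (hΛ : ∀ Y, ‖Λ Y‖ ≤ θ * ‖Y‖) (hW : Prop4Hyp W𝒱 C₄ a₃) (hB₀ : 0 ≤ B₀)
    (hC₄ : 0 ≤ C₄) (hθ : 0 ≤ θ) {j a ε₄ : ℝ} (hε₄ : 0 ≤ ε₄) (hdom : 2 * (ε₄ + a) ≤ a₃)
    (hself : B₀ * j + θ * (ε₄ + a) + B₀ * C₄ * (ε₄ + a) ^ 2 ≤ ε₄) (hcontr : θ + 4 * B₀ * C₄ * (ε₄ + a) < 1)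
    {Rad : ℝ} (hRad1 : 1 < Rad) (Jof : E → 𝒵) (𝔄of : E → 𝒴) (Jf : E → ℂ → 𝒵) (𝔄f : E → ℂ → 𝒴)
    (hJd : ∀ x ∈ W, DifferentiableOn ℂ (Jf x) (ball 0 Rad)) (h𝔄d : ∀ x ∈ W, DifferentiableOn ℂ (𝔄f x) (ball 0 Rad))
    (hJ : ∀ x ∈ W, ∀ σ ∈ ball (0 : ℂ) Rad, ‖Jf x σ‖ ≤ j) (h𝔄 : ∀ x ∈ W, ∀ σ ∈ ball (0 : ℂ) Rad, ‖𝔄f x σ‖ < a)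
    (hJ0 : ∀ x ∈ W, Jf x 0 = 0) (h𝔄0 : ∀ x ∈ W, 𝔄f x 0 = 0)
    (hJray : ∀ x ∈ W, ∀ c : ℝ, 0 ≤ c → c ≤ 1 → Jf x c = Jof (c • x))
    (h𝔄ray : ∀ x ∈ W, ∀ c : ℝ, 0 ≤ c → c ≤ 1 → 𝔄f x c = 𝔄of (c • x))
    {C : 𝒴' → 𝒳} {C₂ R : ℝ} (hC₂ : 0 ≤ C₂) (hCq : ∀ Z : 𝒴', ‖Z‖ < R → ‖C Z‖ ≤ C₂ * ‖Z‖ ^ 2)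
    (hCd : DifferentiableOn ℂ C (ball 0 R)) (ι : 𝒴 →L[ℂ] 𝒴') (hι : ∀ Y, ‖ι Y‖ ≤ ‖Y‖) (H : 𝒳 →L[ℂ] 𝒴)
    (hH : ∀ X, ‖H X‖ ≤ B₀ * ‖X‖) (hq : 9 * C₂ * B₀ * (ε₄ + a) < 1) (hRC : 3 * (ε₄ + a) ≤ R)
    (ℓs : 𝔭 → List (𝒴 →L[ℂ] A)) {κ : ℝ} (hκ : 0 ≤ κ) (hℓ : ∀ p ∈ Pu, ∀ ℓ ∈ ℓs p, ∀ Y, ‖ℓ Y‖ ≤ κ * ‖Y‖)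
    {κc : ℝ} (hκc : 0 ≤ κc) (hcurl : ∀ p ∈ Pu, ∀ Y, ‖((ℓs p).map fun ℓ => ℓ Y).sum‖ ≤ κc * ‖Y‖)
    {m : ℕ} (hlen : ∀ p ∈ Pu, (ℓs p).length ≤ m) :
    ∀ x ∈ W, ∀ p ∈ Pu, ∃ f : ℂ → A, DifferentiableOn ℂ f (ball 0 Rad) ∧
      (∀ w ∈ ball (0 : ℂ) Rad, ‖f w‖ ≤
        κc * ((ε₄ + a) + B₀ * (4 * C₂ * (ε₄ + a) ^ 2)) +
          expTail₂ (m * (κ * ((ε₄ + a) + B₀ * (4 * C₂ * (ε₄ + a) ^ 2))))) ∧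
      f 0 = 0 ∧ ∀ c : ℝ, 0 ≤ c → c ≤ 1 → f (c : ℂ) =
        holOf (ℓs p) (fun y => landauExp C ι H (4 * C₂ * (ε₄ + a) ^ 2)
          (solAt 𝒢 Λ W𝒱 ε₄ (Jof y) (𝔄of y) + 𝔄of y)) (c • x) - 1 := by
  have hRad : 0 < Rad := by linarith
  -- nothing to show on an empty window; otherwise `0 < a` and the bound `z̄ ≥ 0`
  intro x hx
  have ha : 0 < a := (norm_nonneg _).trans_lt (h𝔄 x hx 0 (mem_ball_self hRad))
  have hεa : 0 < ε₄ + a := by linarith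
  have hz : 0 ≤ (ε₄ + a) + B₀ * (4 * C₂ * (ε₄ + a) ^ 2) := by positivity
  refine hAN_of_consistentCurves_stokes ℓs hκ hℓ hκc hcurl hlen
    (fun y => landauExp C ι H (4 * C₂ * (ε₄ + a) ^ 2) (solAt 𝒢 Λ W𝒱 ε₄ (Jof y) (𝔄of y) + 𝔄of y)) hz
    (fun x σ => landauExp C ι H (4 * C₂ * (ε₄ + a) ^ 2) (solAt 𝒢 Λ W𝒱 ε₄ (Jf x σ) (𝔄f x σ) + 𝔄f x σ))
    (fun x hx => (landauCurve_along h𝒢 hΛ hW hB₀ hC₄ hθ hε₄ hdom hself hcontr hRad (hJd x hx) (h𝔄d x hx)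
      (hJ x hx) (h𝔄 x hx) (hJ0 x hx) (h𝔄0 x hx) hC₂ hCq hCd ι hι H hH hq hRC).1)
    (fun x hx => (landauCurve_along h𝒢 hΛ hW hB₀ hC₄ hθ hε₄ hdom hself hcontr hRad (hJd x hx) (h𝔄d x hx)
      (hJ x hx) (h𝔄 x hx) (hJ0 x hx) (h𝔄0 x hx) hC₂ hCq hCd ι hι H hH hq hRC).2)
    (fun x hx => ?_) (fun x hx c hc0 hc1 => ?_) x hx
  · -- flat centre: `𝒜₁(0) = 0` (`solAt_along`), `𝔄_x 0 = 0`, `Ψ̂(0) = 0` (`landauExp_zero`)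
    have hX0 := (solAt_along h𝒢 hΛ hW hB₀ hC₄ hθ hε₄ hdom hself hcontr hRad (hJd x hx) (h𝔄d x hx) (hJ x hx)
      (h𝔄 x hx) (hJ0 x hx) (h𝔄0 x hx)).2.2
    show landauExp C ι H (4 * C₂ * (ε₄ + a) ^ 2) (solAt 𝒢 Λ W𝒱 ε₄ (Jf x 0) (𝔄f x 0) + 𝔄f x 0) = 0
    rw [hX0, h𝔄0 x hx, add_zero]
    exact landauExp_zero hC₂ hCq hCd hι hB₀ hH hq hRC hεa
  · show landauExp C ι H (4 * C₂ * (ε₄ + a) ^ 2) (solAt 𝒢 Λ W𝒱 ε₄ (Jf x c) (𝔄f x c) + 𝔄f x c) =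
      landauExp C ι H (4 * C₂ * (ε₄ + a) ^ 2) (solAt 𝒢 Λ W𝒱 ε₄ (Jof (c • x)) (𝔄of (c • x)) + 𝔄of (c • x))
    rw [hJray x hx c hc0 hc1, h𝔄ray x hx c hc0 hc1]

end Scheme

/-! ## §4 The chart-ray instance on `E = Fin n → ℝ`, Stokes currency -/

section ChartRay

variable {n : ℕ} {ℬ : Type*} [NormedAddCommGroup ℬ] [NormedSpace ℂ ℬ] [CompleteSpace 𝒴] [CompleteSpace 𝒳]
  {𝒢 : 𝒵 →L[ℂ] 𝒴} {W𝒱 : 𝒴 → 𝒵} {B₀ C₄ a₃ : ℝ}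

/-- **END-II's `hAN` ON THE CHART-RAY INSTANCE, STOKES CURRENCY — THE CANONICAL LANDAU HOLONOMY, NO DICTIONARY.**  Binders:
exactly those of `ShellMeasureLandauHolonomyChart.hAN_landau_chartRay` (chart space `Fin n → ℝ`; window
`W ⊆ closedBall 0 S`, `0 < S`; coarse-field map `Φ` holomorphic on the polydisc `‖z‖ < r_Φ`, `Φ 0 = 0`, `‖Φ z‖ < b` ((75)
TYPE), `S < r_Φ`; (103) `hH₁`; `J ≡ 0`, `Λ = 0`; (P2) `h𝒢`; (P4) `hW`; (118)∕(121) at `a = B₀b`, `j = 0`; (44)+[4] Prop. 7;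
scaling; (46); (54)-smallness; read-outs `‖ℓ Y‖ ≤ κ‖Y‖`, length `≤ m`) PLUS the curl read-out
`hcurl : ∀ p ∈ P_u, ∀ Y, ‖((ℓs p).map (· Y)).sum‖ ≤ κ_c‖Y‖`.  CONCLUSION: END-II's `hAN` on the disc `‖w‖ < r_Φ∕S` for the
DEFINED holonomy `hol p := holOf (ℓs p) (y ↦ landauExp C ι H (4C₂(ε₄+B₀b)²) (solAt 𝒢 0 W𝒱 ε₄ 0 (H₁ (Φ (cplx y))) + H₁ (Φ
(cplx y))))`, with the STOKES `H_AN = κ_c·z̄ + expTail₂(m·κ·z̄)`, `z̄ = (ε₄ + B₀b) + 4C₂B₀(ε₄ + B₀b)²` — second order in the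
fine-bond letters once `κ_c ∝ η²`, `κ·z̄ ∝ η` (§5).  NOT an instance of Bałaban's minimiser; NE7c NOT PROVED. [folklore] -/
theorem hAN_landau_chartRay_stokes {𝔭 : Type*} {W : Set (Fin n → ℝ)} {Pu : Finset 𝔭} {S : ℝ} (hS : 0 < S)
    (hWS : W ⊆ closedBall (0 : Fin n → ℝ) S)
    (h𝒢 : ∀ f, ‖𝒢 f‖ ≤ B₀ * ‖f‖) (hW : Prop4Hyp W𝒱 C₄ a₃) (hB₀ : 0 < B₀) (hC₄ : 0 ≤ C₄)
    {b ε₄ : ℝ} (hε₄ : 0 ≤ ε₄) (hdom : 2 * (ε₄ + B₀ * b) ≤ a₃)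
    (hself : B₀ * C₄ * (ε₄ + B₀ * b) ^ 2 ≤ ε₄) (hcontr : 4 * B₀ * C₄ * (ε₄ + B₀ * b) < 1)
    (H₁ : ℬ →L[ℂ] 𝒴) (hH₁ : ∀ B, ‖H₁ B‖ ≤ B₀ * ‖B‖)
    {Φ : (Fin n → ℂ) → ℬ} {rΦ : ℝ} (hΦd : DifferentiableOn ℂ Φ (ball 0 rΦ)) (hΦ0 : Φ 0 = 0)
    (hΦ : ∀ z ∈ ball (0 : Fin n → ℂ) rΦ, ‖Φ z‖ < b) (hSr : S < rΦ)
    {C : 𝒴' → 𝒳} {C₂ R : ℝ} (hC₂ : 0 ≤ C₂) (hCq : ∀ Z : 𝒴', ‖Z‖ < R → ‖C Z‖ ≤ C₂ * ‖Z‖ ^ 2)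
    (hCd : DifferentiableOn ℂ C (ball 0 R)) (ι : 𝒴 →L[ℂ] 𝒴') (hι : ∀ Y, ‖ι Y‖ ≤ ‖Y‖) (H : 𝒳 →L[ℂ] 𝒴)
    (hH : ∀ X, ‖H X‖ ≤ B₀ * ‖X‖) (hq : 9 * C₂ * B₀ * (ε₄ + B₀ * b) < 1) (hRC : 3 * (ε₄ + B₀ * b) ≤ R)
    (ℓs : 𝔭 → List (𝒴 →L[ℂ] A)) {κ : ℝ} (hκ : 0 ≤ κ) (hℓ : ∀ p ∈ Pu, ∀ ℓ ∈ ℓs p, ∀ Y, ‖ℓ Y‖ ≤ κ * ‖Y‖)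
    {κc : ℝ} (hκc : 0 ≤ κc) (hcurl : ∀ p ∈ Pu, ∀ Y, ‖((ℓs p).map fun ℓ => ℓ Y).sum‖ ≤ κc * ‖Y‖)
    {m : ℕ} (hlen : ∀ p ∈ Pu, (ℓs p).length ≤ m) :
    ∀ x ∈ W, ∀ p ∈ Pu, ∃ f : ℂ → A, DifferentiableOn ℂ f (ball 0 (rΦ / S)) ∧
      (∀ w ∈ ball (0 : ℂ) (rΦ / S), ‖f w‖ ≤
        κc * ((ε₄ + B₀ * b) + B₀ * (4 * C₂ * (ε₄ + B₀ * b) ^ 2)) +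
          expTail₂ (m * (κ * ((ε₄ + B₀ * b) + B₀ * (4 * C₂ * (ε₄ + B₀ * b) ^ 2))))) ∧
      f 0 = 0 ∧ ∀ c : ℝ, 0 ≤ c → c ≤ 1 → f (c : ℂ) =
        holOf (ℓs p) (fun y => landauExp C ι H (4 * C₂ * (ε₄ + B₀ * b) ^ 2)
          (solAt 𝒢 0 W𝒱 ε₄ (0 : 𝒵) (H₁ (Φ (cplx y))) + H₁ (Φ (cplx y)))) (c • x) - 1 := by
  have hRad1 : 1 < rΦ / S := by rw [lt_div_iff₀ hS]; linarith
  have hray := fun x (hx : x ∈ W) =>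
    rayData_chart H₁ hH₁ hB₀ hΦd hΦ0 hΦ hS (mem_closedBall_zero_iff.1 (hWS hx))
  have hΛ : ∀ Y : 𝒴, ‖(0 : 𝒴 →L[ℂ] 𝒴) Y‖ ≤ 0 * ‖Y‖ := fun Y => by simp
  have hself' : B₀ * 0 + 0 * (ε₄ + B₀ * b) + B₀ * C₄ * (ε₄ + B₀ * b) ^ 2 ≤ ε₄ := by simpa using hself
  have hcontr' : 0 + 4 * B₀ * C₄ * (ε₄ + B₀ * b) < 1 := by simpa using hcontr
  exact hAN_landau_of_consistentData_stokes h𝒢 hΛ hW hB₀.le hC₄ le_rfl hε₄ hdom hself' hcontr' hRad1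
    (fun _ => (0 : 𝒵)) (fun y => H₁ (Φ (cplx y))) (fun _ _ => (0 : 𝒵)) (fun x σ => H₁ (Φ (σ • cplx x)))
    (fun x _ => (currentData_zero (𝒵 := 𝒵) (rΦ / S)).1) (fun x hx => (hray x hx).1)
    (fun x _ => (currentData_zero (𝒵 := 𝒵) (rΦ / S)).2.1) (fun x hx => (hray x hx).2.2.1)
    (fun x _ => rfl) (fun x hx => (hray x hx).2.1) (fun _ _ _ _ _ => rfl) (fun x hx => (hray x hx).2.2.2)
    hC₂ hCq hCd ι hι H hH hq hRC ℓs hκ hℓ hκc hcurl hlen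

end ChartRay

/-! ## §5 The (SM) junction in the Stokes currency -/

omit [NormedRing A] [NormedAlgebra ℂ A] [CompleteSpace A] [AddCommGroup E] [Module ℝ E] in
/-- **(SM) FOR THE STOKES `H_AN`, η-FREE.**  With the η-scalings of the read-out data DISPLAYED as hypotheses — curl
read-out times field size `κ_c·z̄ ≤ c₁·η²·z` (B11 (25)∕(37) TYPE), letter size `κ·z̄ ≤ c₂·η·z` ((19) TYPE), the regime
`m·(κ·z̄) ≤ 1` — and the UNIT-currency smallness `36·(c₁z + m²c₂²z²)∕(R − 1)² ≤ δ·ε`, END-II's `hSM` HOLDS LITERALLY at the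
pair `(H, θ) = (κ_c·z̄ + expTail₂(m·(κ·z̄)), ε·η²)`, the `H` of §2–§4: S72 `stokes_H_le` + `stokes_hSM`, the `η²` CANCELS.
(The letter-wise `H = e^{mκz̄} − 1` fails this below an explicit `η*`: S72 `letterwise_hSM_fails`.) [folklore] -/
theorem hSM_of_stokes {κ κc zbar c₁ c₂ z η Rad δ ε : ℝ} {m : ℕ} (hRad : 1 < Rad) (hη : 0 < η)
    (hκz : 0 ≤ κ * zbar) (hs₁ : κc * zbar ≤ c₁ * η ^ 2 * z) (ha : κ * zbar ≤ c₂ * η * z)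
    (hma : m * (κ * zbar) ≤ 1) (hsm : 36 * (c₁ * z + m ^ 2 * c₂ ^ 2 * z ^ 2) / (Rad - 1) ^ 2 ≤ δ * ε) :
    36 * (κc * zbar + expTail₂ (m * (κ * zbar))) * 1 ^ 2 / (Rad - 1) ^ 2 ≤ δ * (ε * η ^ 2) :=
  stokes_hSM hRad hη (stokes_H_le hκz hs₁ ha hma) hsm

omit [NormedRing A] [NormedAlgebra ℂ A] [CompleteSpace A] [AddCommGroup E] [Module ℝ E] in
/-- the Stokes `H` is nonnegative (END-II's slot arithmetic wants `0 ≤ H` implicitly through `hSM`; recorded for the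
consumer). [folklore] -/
theorem stokesH_nonneg {κ κc zbar : ℝ} {m : ℕ} (hκc : 0 ≤ κc) (hz : 0 ≤ zbar) :
    0 ≤ κc * zbar + expTail₂ (m * (κ * zbar)) :=
  add_nonneg (mul_nonneg hκc hz) (expTail₂_nonneg _)

/-! ## §6 Non-vacuity: the Stokes `hAN` fires on the one-mode model -/

/-- **`hAN_landau_chartRay_stokes` FIRES** on leaf-02's model (`ShellMeasureLandauHolonomyToy`: `S = 1`, `r_Φ = 200`,
`B₀ = 1`, `C₄ = 0`, `a₃ = 1`, `b = 1∕50`, `ε₄ = 10⁻³`, `C₂ = 1`, `R = 1`, one read-out `id`, `κ = 1`, `m = 1`) with the curl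
binder inhabited by `κ_c = 1` (one letter: the letter sum IS the letter): every binder jointly inhabited, conclusion =
END-II's `hAN` on `‖w‖ < 200` with the Stokes `H = 1·z̄ + expTail₂(1·(1·z̄))`. [folklore] -/
example :
    ∀ x ∈ closedBall (0 : Fin 1 → ℝ) 1, ∀ p ∈ ({()} : Finset Unit), ∃ f : ℂ → ℂ,
      DifferentiableOn ℂ f (ball 0 (200 / 1)) ∧
      (∀ w ∈ ball (0 : ℂ) (200 / 1), ‖f w‖ ≤
        1 * ((1 / 1000 + 1 * (1 / 50)) + 1 * (4 * 1 * (1 / 1000 + 1 * (1 / 50)) ^ 2)) +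
          expTail₂ ((1 : ℕ) * (1 * ((1 / 1000 + 1 * (1 / 50)) + 1 * (4 * 1 * (1 / 1000 + 1 * (1 / 50)) ^ 2))))) ∧
      f 0 = 0 ∧ ∀ c : ℝ, 0 ≤ c → c ≤ 1 → f (c : ℂ) = holOf [(ContinuousLinearMap.id ℂ ℂ)] toyZ (c • x) - 1 := by
  obtain ⟨hΦd, hΦ0, hΦ⟩ := toy_chartMap
  obtain ⟨hCq, hCd⟩ := toy_sectC
  exact hAN_landau_chartRay_stokes (𝔭 := Unit) (Pu := {()}) one_pos subset_rfl toy_id_bound toy_prop4 one_pos le_rfl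
    (b := 1 / 50) (ε₄ := 1 / 1000) (by norm_num) (by norm_num) (by norm_num) (by norm_num) (ContinuousLinearMap.id ℂ ℂ)
    toy_id_bound hΦd hΦ0 hΦ (by norm_num) (C₂ := 1) (R := 1) zero_le_one hCq hCd (ContinuousLinearMap.id ℂ ℂ)
    (fun Y => by simp) (ContinuousLinearMap.id ℂ ℂ) toy_id_bound (by norm_num) (by norm_num)
    (fun _ => [(ContinuousLinearMap.id ℂ ℂ)]) zero_le_one
    (fun _ _ ℓ hℓ Y => by rw [List.mem_singleton] at hℓ; subst hℓ; simp) zero_le_one (fun _ _ Y => by simp)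
    (m := 1) (fun _ _ => by simp)

end Summit.QuantumFields.BalabanUV.T4Continuum.ShellMeasureLandauHolonomyStokes

end
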